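import Summits.CriticalPhenomena.PercolationContinuityZ3.Theorems.PercNearOneGluingNoHeavyConstsCrossReachMarkerPinnedEdgeExchanges
import Summits.CriticalPhenomena.PercolationContinuityZ3.Theorems.PercNearOneGluingNoHeavyConstsCrossReachMarkerPinnedEdgeExchangesM1
import Summits.CriticalPhenomena.PercolationContinuityZ3.Theorems.PercNearOneGluingNoHeavyConstsCrossReachMarkerSaturatedEdge
import Summits.CriticalPhenomena.PercolationContinuityZ3.Theorems.PercNearOneGluingNoHeavyConstsCrossLayerCake
import HarnessLib

/-!
# CROSS at the marker `u = z` for every monotone functional of the open EDGE cluster in a marker class, unconditionally (assembly; gen 21)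

builds on p205010 (kernel theorem, internal audit signed; external expert review pending).  Support file (`--supports
stmt-CriticalPhenomena-4575`); theorems only, no sorries, standard axioms.  Memo `run/shared/lean/prim/consts/FROM-prim-consts-2-g21-GIBBS-ORBIT.md` §3c.

* `Consts.crossRel_edge_of_markerComparable` — both `u = z` members of `Consts.CrossRel` are `≥ 0` for every monotone 0/1-valued functional `F` of the
  open edge cluster with `F(C_s) = 1 ⟹ s↔y` (pinned; `…CrossReachMarkerPinnedEdgeExchanges{,M1}`) or `s↔y ⟹ F(C_s) = 1` (saturated;
  `…CrossReachMarkerSaturatedEdge` fed with the pinned corner `F = 1{s↔y}`).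
* `Consts.crossRel_marker_of_markerClass` — **THEOREM: for every weighted graph, all `s, y, z, X` and every MONOTONE `F : Set (Sym2 V) → ℝ` with
  `F(C_s(ω)) ≠ F(∅) ⟹ s↔y` (marker-pinned: `F − F(∅)` supported on `{s↔y}`) or with `s↔y ⟹ F(C_s(ω)) = F(univ)` (marker-saturated), both CROSS members
  at `X ⊂ X ∪ {z}` are `≥ 0`** — the literal `Consts.CrossRel` conclusion at `u = z` on the two marker classes (layer cake `…CrossLayerCake`).
* `Consts.crossMembers_nonneg_of_levelSets` (general layer cake, predicate form, any added vertex `u`) and `Consts.crossRel_marker_of_levelSetsComparable` —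
  the same conclusion for every monotone `F` each of whose upper level sets `{t ≤ F}` (`t > F(∅)` a value) is pinned OR saturated (mixed thresholds allowed).
What remains of `Consts.CrossRel` at `u = z`: monotone `F` with an upper level set comparable with neither `{s↔y}` nor `{s↔z}` (the generic class;
`…ConstsCrossReach` does the `{s↔z}`-classes).
-/

noncomputable section

namespace Summit.CriticalPhenomena.PercolationContinuityZ3.Theorems

open MeasureTheory Set Literature.Probability.LatticeModels Literature.Probability.Percolation
open scoped Classical

namespace Consts

variable {V : Type} [DecidableEq V] [Fintype V] (w : Sym2 V → unitInterval)

/-- **CROSS at `u = z` for every monotone 0/1 functional of the open edge cluster comparable with the marker event**: if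
`F(C_s) = 1 ⟹ s↔y` (pinned) or `s↔y ⟹ F(C_s) = 1` (saturated) then both members are `≥ 0`. [cite: VandenbergHaggstromKahn2005, Thm. 1.1 (pp. 3–5)] -/
theorem crossRel_edge_of_markerComparable (s y z : V) (X : Set V) (F : Set (Sym2 V) → ℝ) (hFm : Monotone F)
    (hF01 : ∀ C, F C = 0 ∨ F C = 1)
    (hcomp : (∀ ω : BondConfig V, F (openEdgeCluster ω s) = 1 → (openGraph ω).Reachable s y) ∨
      (∀ ω : BondConfig V, (openGraph ω).Reachable s y → F (openEdgeCluster ω s) = 1)) :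
    (0 ≤ polMargin (prodBernoulli w) s y z F (insert z X) X X + polMargin (prodBernoulli w) s y z F X (insert z X) X +
        polMargin (prodBernoulli w) s y z F X X (insert z X)) ∧
      0 ≤ polMargin (prodBernoulli w) s y z F (insert z X) (insert z X) X +
          polMargin (prodBernoulli w) s y z F (insert z X) X (insert z X) +
        polMargin (prodBernoulli w) s y z F X (insert z X) (insert z X) := by
  rcases hcomp with hpin | hsat
  · exact ⟨crossRel_edge_M1_of_markerPinned w s y z X F hFm hF01 hpin, crossRel_edge_M2_of_markerPinned w s y z X F hFm hF01 hpin⟩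
  · -- the corner `F = 1{s↔y}` is pinned (and saturated); feed it to the saturated transfer
    have h01 : ∀ C, connIndicatorFn s y C = 0 ∨ connIndicatorFn s y C = 1 := by
      intro C; unfold connIndicatorFn; split_ifs <;> simp
    have hpinY : ∀ ω : BondConfig V, connIndicatorFn s y (openEdgeCluster ω s) = 1 → (openGraph ω).Reachable s y := by
      intro ω h
      rw [connIndicatorFn_openEdgeCluster] at h
      by_contra hn
      rw [Set.indicator_of_notMem (show ω ∉ openConn s y from hn)] at h
      exact zero_ne_one h
    have hY1 := crossRel_edge_M1_of_markerPinned w s y z X (connIndicatorFn s y) (monotone_connIndicatorFn s y) h01 hpinY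
    have hY2 := crossRel_edge_M2_of_markerPinned w s y z X (connIndicatorFn s y) (monotone_connIndicatorFn s y) h01 hpinY
    exact crossRel_edge_of_markerSaturated_of_corner w s y z X F hFm hF01 hsat hY1 hY2

/-- **CROSS at `u = z` on the two marker classes of monotone functionals** (pinned: `F − F(∅)` supported on `{s↔y}`; saturated: `F = F(univ)` on
`{s↔y}`). [cite: VandenbergHaggstromKahn2005, Thm. 1.1 (pp. 3–5), §2.1 (pp. 9–13)] -/
theorem crossRel_marker_of_markerClass (s y z : V) (X : Set V) (F : Set (Sym2 V) → ℝ) (hFm : Monotone F)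
    (hclass : (∀ ω : BondConfig V, F (openEdgeCluster ω s) ≠ F ∅ → (openGraph ω).Reachable s y) ∨
      (∀ ω : BondConfig V, (openGraph ω).Reachable s y → F (openEdgeCluster ω s) = F Set.univ)) :
    (0 ≤ polMargin (prodBernoulli w) s y z F (insert z X) X X + polMargin (prodBernoulli w) s y z F X (insert z X) X +
        polMargin (prodBernoulli w) s y z F X X (insert z X)) ∧
      0 ≤ polMargin (prodBernoulli w) s y z F (insert z X) (insert z X) X +
          polMargin (prodBernoulli w) s y z F (insert z X) X (insert z X) +
        polMargin (prodBernoulli w) s y z F X (insert z X) (insert z X) := by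
  rcases hclass with hpin | hsat
  · exact crossMembers_nonneg_of_levelSets_pinned w s y z z X
      (fun G hGm hG01 hGy => crossRel_edge_of_markerComparable w s y z X G hGm hG01 (Or.inl hGy)) F hFm hpin
  · exact crossMembers_nonneg_of_levelSets_saturated w s y z z X
      (fun G hGm hG01 hGy => crossRel_edge_of_markerComparable w s y z X G hGm hG01 (Or.inr hGy)) F hFm hsat

omit [DecidableEq V] in
/-- **General layer cake (predicate form).**  If both CROSS members at `X ⊂ X ∪ {u}` are `≥ 0` for every monotone 0/1-valued functional `G` with `Pcl G`, and
every upper level-set indicator `1{t ≤ F}` of the monotone functional `F` at a value `t > F(∅)` of `F` satisfies `Pcl`, then both members are `≥ 0` for `F`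
(finite induction on the number of values, peeling the lowest level). [folklore] -/
theorem crossMembers_nonneg_of_levelSets (s y z u : V) (X : Set V) (Pcl : (Set (Sym2 V) → ℝ) → Prop)
    (h01 : ∀ G : Set (Sym2 V) → ℝ, Monotone G → (∀ C, G C = 0 ∨ G C = 1) → Pcl G →
      (0 ≤ polMargin (prodBernoulli w) s y z G (insert u X) X X + polMargin (prodBernoulli w) s y z G X (insert u X) X +
          polMargin (prodBernoulli w) s y z G X X (insert u X)) ∧
        0 ≤ polMargin (prodBernoulli w) s y z G (insert u X) (insert u X) X + polMargin (prodBernoulli w) s y z G (insert u X) X (insert u X) +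
          polMargin (prodBernoulli w) s y z G X (insert u X) (insert u X))
    (F : Set (Sym2 V) → ℝ) (hF : Monotone F)
    (hlev : ∀ t : ℝ, F ∅ < t → (∃ C, F C = t) → Pcl (fun C => if t ≤ F C then 1 else 0)) :
    (0 ≤ polMargin (prodBernoulli w) s y z F (insert u X) X X + polMargin (prodBernoulli w) s y z F X (insert u X) X +
        polMargin (prodBernoulli w) s y z F X X (insert u X)) ∧
      0 ≤ polMargin (prodBernoulli w) s y z F (insert u X) (insert u X) X + polMargin (prodBernoulli w) s y z F (insert u X) X (insert u X) +
        polMargin (prodBernoulli w) s y z F X (insert u X) (insert u X) := by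
  suffices key : ∀ (n : ℕ) (F : Set (Sym2 V) → ℝ), Monotone F →
      (∀ t : ℝ, F ∅ < t → (∃ C, F C = t) → Pcl (fun C => if t ≤ F C then 1 else 0)) →
      (Set.finite_range F).toFinset.card = n →
      0 ≤ (polMargin (prodBernoulli w) s y z F (insert u X) X X + polMargin (prodBernoulli w) s y z F X (insert u X) X +
          polMargin (prodBernoulli w) s y z F X X (insert u X)) ∧
        0 ≤ (polMargin (prodBernoulli w) s y z F (insert u X) (insert u X) X + polMargin (prodBernoulli w) s y z F (insert u X) X (insert u X) +
          polMargin (prodBernoulli w) s y z F X (insert u X) (insert u X)) by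
    exact key _ F hF hlev rfl
  intro n
  induction n using Nat.strong_induction_on with
  | _ n ih =>
  intro F hF hlev hn
  by_cases hconst : ∀ C, F C = F ∅
  · have hFc : F = fun _ => F ∅ := funext hconst
    rw [hFc]
    simp only [polMargin_const', add_zero, le_refl, and_self]
  push Not at hconst
  obtain ⟨C₀, hC₀⟩ := hconst
  set m := F ∅ with hm
  set T := (Set.finite_range F).toFinset.erase m with hT
  have hTne : T.Nonempty := ⟨F C₀, Finset.mem_erase.mpr ⟨hC₀, (Set.finite_range F).mem_toFinset.mpr ⟨C₀, rfl⟩⟩⟩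
  set m' := T.min' hTne with hm'
  have hm'T : m' ∈ T := Finset.min'_mem T hTne
  have hm'ne : m' ≠ m := (Finset.mem_erase.mp hm'T).1
  have hmin : ∀ C, m ≤ F C := fun C => hF (empty_subset C)
  have hm'C : ∃ C, F C = m' := by
    have := (Finset.mem_erase.mp hm'T).2
    rw [Set.Finite.mem_toFinset] at this
    exact this
  have hmm' : m < m' := by
    obtain ⟨C, hC⟩ := hm'C
    exact lt_of_le_of_ne (hC ▸ hmin C) (Ne.symm hm'ne)
  have hgap : ∀ C, F C < m' → F C = m := by
    intro C hC
    by_contra hne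
    have hmem : F C ∈ T := Finset.mem_erase.mpr ⟨hne, (Set.finite_range F).mem_toFinset.mpr ⟨C, rfl⟩⟩
    exact absurd (Finset.min'_le T (F C) hmem) (not_le.mpr (hm' ▸ hC))
  set G : Set (Sym2 V) → ℝ := fun C => if m' ≤ F C then 1 else 0 with hG
  set F' : Set (Sym2 V) → ℝ := fun C => max (F C) m' with hF'
  have hGm : Monotone G := by
    intro C C' hCC'
    simp only [hG]
    by_cases h : m' ≤ F C
    · rw [if_pos h, if_pos (h.trans (hF hCC'))]
    · rw [if_neg h]; split_ifs <;> norm_num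
  have hG01 : ∀ C, G C = 0 ∨ G C = 1 := fun C => by simp only [hG]; split_ifs <;> simp
  have hGP : Pcl G := hlev m' hmm' hm'C
  have hF'm : Monotone F' := fun C C' hCC' => max_le_max (hF hCC') le_rfl
  have hF'e : F' ∅ = m' := by simp only [hF']; exact max_eq_right hmm'.le
  have hF'lev : ∀ t : ℝ, F' ∅ < t → (∃ C, F' C = t) → Pcl (fun C => if t ≤ F' C then 1 else 0) := by
    intro t ht hex
    rw [hF'e] at ht
    have heq : (fun C => if t ≤ F' C then (1 : ℝ) else 0) = fun C => if t ≤ F C then 1 else 0 := by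
      funext C
      have : (t ≤ F' C) ↔ (t ≤ F C) := by
        simp only [hF', le_max_iff]
        exact ⟨fun h => h.elim id (fun h' => absurd h' (not_le.mpr ht)), fun h => Or.inl h⟩
      simp only [this]
    rw [heq]
    obtain ⟨C, hC⟩ := hex
    have hFC : F C = t := by
      have h1 : max (F C) m' = t := hC
      rcases le_or_gt m' (F C) with h | h
      · rwa [max_eq_left h] at h1
      · rw [max_eq_right h.le] at h1; exact absurd h1 (ne_of_lt ht)
    exact hlev t (hmm'.trans ht) ⟨C, hFC⟩
  have hdec : F = fun C => (fun C => F' C + (m' - m) * G C) C + (m - m') * (fun _ : Set (Sym2 V) => (1 : ℝ)) C := by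
    funext C
    simp only [hF', hG]
    by_cases h : m' ≤ F C
    · rw [if_pos h, max_eq_left h]; ring
    · rw [if_neg h, max_eq_right (not_le.mp h).le, hgap C (not_le.mp h)]; ring
  have hcard : (Set.finite_range F').toFinset.card < n := by
    have hsub : (Set.finite_range F').toFinset = T := by
      ext v
      simp only [hT, Finset.mem_erase, Set.Finite.mem_toFinset, Set.mem_range]
      constructor
      · rintro ⟨C, rfl⟩
        refine ⟨?_, ?_⟩
        · simp only [hF']; exact ne_of_gt (hmm'.trans_le (le_max_right _ _))
        · by_cases h : m' ≤ F C
          · exact ⟨C, by simp only [hF', max_eq_left h]⟩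
          · obtain ⟨C', hC'⟩ := hm'C
            exact ⟨C', by simp only [hF', max_eq_right (not_le.mp h).le, hC']⟩
      · rintro ⟨hne, C, rfl⟩
        refine ⟨C, ?_⟩
        simp only [hF']
        exact max_eq_left (not_lt.mp fun hlt => hne (hgap C hlt))
    rw [hsub, hT, Finset.card_erase_of_mem ((Set.finite_range F).mem_toFinset.mpr ⟨∅, rfl⟩), hn]
    have : 0 < n := by
      rw [← hn]; exact Finset.card_pos.mpr ⟨m, (Set.finite_range F).mem_toFinset.mpr ⟨∅, rfl⟩⟩
    omega
  have ihF' := ih _ hcard F' hF'm hF'lev rfl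
  have hGpos := h01 G hGm hG01 hGP
  have hc : 0 ≤ m' - m := sub_nonneg.mpr hmm'.le
  have p1 := mul_nonneg hc hGpos.1
  have p2 := mul_nonneg hc hGpos.2
  rw [hdec]
  simp only [polMargin_add_mul, polMargin_const', mul_zero, add_zero]
  constructor
  · nlinarith [ihF'.1, p1]
  · nlinarith [ihF'.2, p2]

/-- **CROSS at `u = z` for every monotone functional whose upper level sets are each marker-comparable** (for every value `t > F(∅)`:
either `t ≤ F(C_s) ⟹ s↔y` or `s↔y ⟹ t ≤ F(C_s)`; mixed thresholds allowed).  [cite: VandenbergHaggstromKahn2005, Thm. 1.1 (pp. 3–5), §2.1 (pp. 9–13)] -/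
theorem crossRel_marker_of_levelSetsComparable (s y z : V) (X : Set V) (F : Set (Sym2 V) → ℝ) (hFm : Monotone F)
    (hlev : ∀ t : ℝ, F ∅ < t → (∃ C, F C = t) →
      (∀ ω : BondConfig V, t ≤ F (openEdgeCluster ω s) → (openGraph ω).Reachable s y) ∨
        (∀ ω : BondConfig V, (openGraph ω).Reachable s y → t ≤ F (openEdgeCluster ω s))) :
    (0 ≤ polMargin (prodBernoulli w) s y z F (insert z X) X X + polMargin (prodBernoulli w) s y z F X (insert z X) X +
        polMargin (prodBernoulli w) s y z F X X (insert z X)) ∧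
      0 ≤ polMargin (prodBernoulli w) s y z F (insert z X) (insert z X) X +
          polMargin (prodBernoulli w) s y z F (insert z X) X (insert z X) +
        polMargin (prodBernoulli w) s y z F X (insert z X) (insert z X) := by
  refine crossMembers_nonneg_of_levelSets w s y z z X
    (fun G => (∀ ω : BondConfig V, G (openEdgeCluster ω s) = 1 → (openGraph ω).Reachable s y) ∨
      (∀ ω : BondConfig V, (openGraph ω).Reachable s y → G (openEdgeCluster ω s) = 1))
    (fun G hGm hG01 hP => crossRel_edge_of_markerComparable w s y z X G hGm hG01 hP) F hFm ?_
  intro t ht hex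
  rcases hlev t ht hex with h | h
  · left
    intro ω hω
    have : t ≤ F (openEdgeCluster ω s) := by
      by_contra hn; simp only [if_neg hn] at hω; exact zero_ne_one hω
    exact h ω this
  · right
    intro ω hω
    simp only [if_pos (h ω hω)]

end Consts

end Summit.CriticalPhenomena.PercolationContinuityZ3.Theorems

end
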